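import Summits.QuantumFields.YangMills.Theses.AllWindowsColdBox
import Summits.QuantumFields.YangMills.Theorems.AllWindowsColdBoxBoxHighWindowsSU22LineDefs
import Summits.QuantumFields.YangMills.Theorems.AllWindowsColdBoxBoxHighLineHodgeBootstrap
import Summits.QuantumFields.YangMills.Theorems.AllWindowsColdBoxBoxHighLineGaugeBallOfBootstrap
import Summits.QuantumFields.YangMills.Theorems.AllWindowsColdBoxBoxWindowHighSU2213LineDefs
import Summits.QuantumFields.YangMills.Theorems.AllWindowsColdBoxBoxHighLineLandauBallUniqueness
import Summits.QuantumFields.YangMills.Theorems.AllWindowsColdBoxBoxHighLineBulkCurrency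

/-!
# LINE-20 «landau-rung3» — rung 3 of the Landau-sector ladder on the HIGH item ⟨stmt-QuantumFields-24336⟩

v4 (planner ym-idea-2 g18, 2026-08-29T18:5xZ) = v3 with U5's CONCLUSION RE-CUT to the BULK target `LandauRelativeComparisonBulk θL` (tree, `Theorems/AllWindowsColdBoxBoxHighLineBulkCurrency.lean` ✓p738430: comparison at separations `L ≤ T ≤ H/M`; the only consumer ✓p706506 evaluates at `T = ⌈β^A⌉₊`, so the wall layer was never needed and is out of reach of a finite-order expansion) and the compositions routed through the tree theorem `boxWindow_of_dirichletDominationBulk_ceiling : RelativeCurrencyBulk`; U1 U2 U6 texts byte-identical to v3.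
# `Summit.QuantumFields.YangMills.Theses.AllWindowsColdBox.BoxWindowHighSU2213` (windows θ > 1/13 of the R2ξ″ all-windows crux ⟨24004⟩)

Seat ym-idea-2 g17 (planner-ym-idea-2-g17-0, D-0145 ideator; technique card «recent-theorem open-question harvest»).  Route
`route-QuantumFields-AllWindowsColdBox` (DRAFT by design).  Sibling of LINE-19 «landau-sector-relative-bl» (`Cruxes/BoxHighWindowsSU22/Lines/
landau_sector_relative_bl.lean`, v11, critic idea-crit-4 PASS), whose declared residual S6 IS this item.

IDEA.  LINE-19 books the LOW sub-window θ ≤ 1/13 at rung k = 2 because three constraints coincide at θ < 1/12: (i) the second-order remainder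
`σ² ≍ H⁴(log H)^m/β` against the `T⁻⁸ ≥ H⁻⁸` floor (12θ < 1); (ii) the premise `s·H⁴(1+log H)² ≤ c₀` of the one-step-bootstrap representative
bound `LandauBootstrapBound` at the plaquette scale `s = β^{ε−1/2}`, ε > 2θ (6θ < 1/2); (iii) the Gribov/convexity interlock typed as `κ < 1/2 − 3θL`
with the representative forcing κ > 3θL (6θL < 1/2).  Each has a next rung, and the three next rungs coincide again, at θ < 1/10:
 (i′) evaluate the order-β⁻¹ (one-loop) classes instead of bounding them — in the Landau sector every class is a lattice sum of DECAYING kernels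
      (`(1+d)⁻²` links, `(1+d)⁻³` gradient, `(1+d)⁻⁴` dipole), so `|c₁(H,T)| ≤ C(log H)^m·H²·T⁻⁶ ≪ β·T⁻⁸` for every θ < 1/4 with NO Ward identity
      (the one-gluon-reducible classes vanish identically: no invariant vector in the adjoint of SU(2)); the third-order remainder `σ³` then closes iff
      14θ < 3/2 (θ < 3/28), and the exponential-moment cap of the tilt on the representative ball (`S·σ² → 0`, S = sup of the cubic tilt) iff 16θ < 3/2
      (θ < 3/32 > 1/11);
 (ii′) the STRONGER representative bound `LandauRepresentativeBound` (premise `s·H³(1+log H) ≤ c₀` ⇔ θ < 1/10; the v9 statement of record, kept in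
      the tree as an unreferenced relic when v10 weakened S4b to the bootstrap form; proof = continuity method, STUB-PLAN-S4b §3);
 (iii′) the SHARP interlock `κ < 1/2 − 2θL`: Gribov uniqueness inside the ball needs only `r·H → 0` (form bound: the only H enters through the
      Poincaré inequality for the gauge parameter, `‖λ‖ ≤ C·H·‖d₀λ‖`), and uniform convexity of `βS` on Slice ∩ Ball(r) needs `r·H + |F|·H² → 0`
      with `|F| ≤ 4r` on the ball; with κ > 3θL this is again θL < 1/10.
So the line attacks the MID window (1/13, 1/11] (filed with margin inside 1/10 ∧ 3/32) and declares (1/11, 7A] the RG residual; its analytic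
stub concludes the SAME transfer target as LINE-19, `LandauRelativeComparison θL`, now for every θL < 1/10, and the landed T-respecting currency
`AllWindowsColdBox.boxWindow_of_dirichletDominationRel_ceiling` (✓p706506) converts it.  CEILING OF THE CHART (honest): 1/10 here; 1/8 with a
representative bound under the premise `s·H²(1+log H)` and the convex body Slice ∩ Ball ∩ {|da_p| ≤ 2s} (not filed); at θ = 1/8 the Gribov horizon
enters the rarity ball (`r·H ≍ 1` with κ = 3θ) and no one-chart method survives — mode separation (Bałaban class) owns θ ≥ 1/8.

REGISTERED STUBS (sorry ONLY in `stub_*`; v3 = FOUR): U1 `stub_landauKernelPackage` (S3 of LINE-19 + gradient + dipole decay; M–L; S3a PROVED ✓`landauVarianceBounded`) · U2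
`stub_landauRepresentativeStrong : LandauRepresentativeBound` (L; the v9 Prop BY NAME) · U5 `stub_landauThirdOrder`
(XL, the analytic heart; critic prereg N2 «c₁(H,T)» governs its STAFFING) · U6 `stub_boxWindowHigh11 : BoxWindowHighSU22 (1/11)` (DECLARED RESIDUAL,
not staffed).  U4 (sharp gauge-ball reduction) is PROVED in this file from U2 (`gaugeBallReductionSharp_of_strong`, `κ = 1/4 + θL/2`, `κ₂ = (1/10 − θL)/8`,
v2); U3 `LandauBallUniqueness` is LANDED BY NAME (✓p723285, fcl-p3 g23) and cited (v3); the five line Props are the tree LineDefs ✓p722050 (v3).  S1 `HodgePoincareColdBox` (✓p719062) and S2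
`DirProjKernelHodgeForm` (✓p717397) are TREE THEOREMS and are cited, not stubbed.

COMPOSITIONS (kernel-checked, no sorry): `boxWindowUpTo_of` (stubs ⇒ every window θ ≤ θL, θL < 1/10), `BoxWindowHighSU2213_of` /
`BoxHighWindowsSU22_of` (hypothesis-carrying, conclude the local aliases), and exactly ONE zero-hypothesis theorem per route decl concluded BY NAME:
`BoxWindowHighSU2213_proof` (⟨24336⟩) and `BoxHighWindowsSU22_proof` (⟨24004⟩, residual moved from θ > 1/13 to θ > 1/11).

INSTRUMENT ROW that would refute the key lemma: I22 (kit j331394, PREREG-I22 frozen 2026-08-29T12:47Z): growth exponent ê of the Landau-slice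
variance of the cubic vertex functional; KILL ê ≥ 7 (order-4 remainder fails at 1/11), LINE-19 retro-KILL ê > 5.  Critic N2 (exact one-loop
coefficient c₁(H,T), KILL «growth H^a·T⁻²» with a ≥ 1/θ₃ − 8 = 3) before U5 is staffed.

HONEST LABEL: a DRAFT line on a DRAFT-by-design route; nothing is proved here; ⟨24336⟩, ⟨24004⟩ stay OPEN; the window (1/11, 7A] is a declared
residual, not attacked; the Yang–Mills mass gap is NOT proved by this file or by the line.
-/

set_option autoImplicit false

noncomputable section

open MeasureTheory Matrix
open Literature.MathematicalPhysics.QuantumFieldTheory hiding SU2 boxEdges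
open Literature.MathematicalPhysics.QuantumFieldTheory.LatticeMaxwell
open Literature.MathematicalPhysics.QuantumFieldTheory.AxialGauge
open Summit.QuantumFields.YangMills.Theorems.WeakCouplingRates
open Summit.QuantumFields.YangMills.Theorems.AllWindowsColdBoxBoxHighLine

namespace Summit.QuantumFields.YangMills.Cruxes.BoxWindowHighSU2213.LandauRung3

/-! ## New obligation Props of the line (the LINE-19 objects `hodgeQ`, `landauCoeff`, `SU2`, `IsInteriorGauge`, `linkDefect`, `InLandauGauge`,
`GaugeBallReduction`, `LandauRelativeComparison`, `LandauRepresentativeBound`, … are the TREE copies of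
`…Theorems.AllWindowsColdBoxBoxHighWindowsSU22LineDefs` / `…BoxHighLineHodgeBootstrap`, opened above) -/

/-! ## Props BY NAME (v3): `LandauDipoleDecay`, `LandauKernelPackage`, `LandauBallUniqueness`, `BoxWindowSU22`, `BoxWindowUpToSU22` are the tree LineDefs
(AllWindowsColdBoxBoxWindowHighSU2213LineDefs, namespace `…Theorems.AllWindowsColdBoxBoxHighLine`, bodies verbatim from v2) — no local copies, so by-name closers land against
the SAME constants the compositions use. -/

/-! ## Registered stubs (sorry ONLY here) -/

/-- **U1 (kernel package; M–L; half of it is LINE-19's S3, in progress: fcl-p3 g22 on S3a).** -/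
theorem stub_landauKernelPackage : LandauKernelPackage := by sorry

/-- **U2 (STRONG small Landau representative = the v9 statement of record `LandauRepresentativeBound` BY NAME; L).**  Premise
`s·H³(1+log H) ≤ c₀` (⇔ θ < 1/10 at the plaquette scale), conclusion per-link defect `≤ C·H²(1+log H)²·s²`.  Logically stronger than LINE-19's S4b
`LandauBootstrapBound` (premise `s·H⁴(1+log H)²`), which it implies for `H ≥ 1`; proof route = continuity method along `t ↦` (plaquette data scaled
by t) with the FP operator inverted in FORM sense (`M(A)[λ,λ] ≥ ‖d₀λ‖²(1 − C·H·|A|_∞)`), STUB-PLAN-S4b §3 (the L plan that v10 traded for the M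
bootstrap). -/
theorem stub_landauRepresentativeStrong : LandauRepresentativeBound := by sorry

/-- **U3 (Gribov uniqueness in the ball, sharp radius `r·H ≤ c₀`) — NOT a stub since v3: LANDED BY NAME ✓p723285 (fcl-p3 g23, monotonicity pairing,
c₀ = 1/32), `…Theorems.AllWindowsColdBoxBoxHighLine.stub_landauBallUniqueness`; cited here.** -/
theorem landauBallUniqueness_holds : LandauBallUniqueness :=
  Summit.QuantumFields.YangMills.Theorems.AllWindowsColdBoxBoxHighLine.stub_landauBallUniqueness

open Literature.MathematicalPhysics.QuantumLattice in
/-- **U4 from U2** (LINE-20): the gauge-ball reduction with the SHARP interlock `κ < 1/2 − 2θL`, for every `θL < 1/10`, from the strong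
small-Landau-representative bound `LandauRepresentativeBound` (premise `s·H³(1+log H) ≤ c₀`, conclusion `C·H²(1+log H)²·s²`).
Exponents: `κ = 1/4 + θL/2` (so `3θL < κ < 1/2 − 2θL` iff `θL < 1/10`), `κ₂ = g = (1/10 − θL)/8`, `ε = 2θ + g`. -/
theorem gaugeBallReductionSharp_of_strong (h2 : LandauRepresentativeBound) :
    ∀ θL : ℝ, θL < 1 / 10 → ∃ κ : ℝ, 0 < κ ∧ κ < 1 / 2 - 2 * θL ∧ GaugeBallReduction θL κ := by
  intro θL hθL
  rcases le_or_gt 0 θL with hθL0 | hθLneg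
  swap
  · -- vacuous range: no `θ` with `0 < θ ≤ θL`
    refine ⟨1 / 4, by norm_num, by linarith, 1, one_pos, fun θ hθ hθle => ?_⟩
    exfalso; linarith
  refine ⟨1 / 4 + θL / 2, by linarith, by linarith, ?_⟩
  obtain ⟨C, c₀, hC, hc₀, h4⟩ := h2
  set g : ℝ := (1 / 10 - θL) / 8 with hg
  have hg0 : 0 < g := by rw [hg]; linarith
  refine ⟨g, hg0, fun θ hθ hθle => ?_⟩
  have hθ10 : θ < 1 / 10 := lt_of_le_of_lt hθle hθL
  set ε : ℝ := 2 * θ + g with hε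
  have h2θε : 2 * θ < ε := by rw [hε]; linarith
  have hgε : g ≤ ε := by rw [hε]; linarith
  -- (R) rarity of large fields in the cold box
  obtain ⟨β₁, hrar⟩ := boxState_largeField_rarity hθ h2θε
  -- (A) the U2 defect fits in the ball: `C (2H+3)² ((3+2/g) β^(g/2))² β^(2ε-1) ≤ β^(2κ-1)`
  obtain ⟨β₂, hβ₂1, hA⟩ := exists_const_mul_boxSide_pow_mul_rpow_le (C * (3 + 2 / g) ^ 2) 2
    (θ := θ) (a := g + (2 * ε - 1)) (b := 2 * (1 / 4 + θL / 2) - 1) hθ (by rw [hε, hg]; push_cast; nlinarith)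
  -- (P) the U2 premise: `β^(ε-1/2) (2H+3)³ (3+2/g) β^(g/2) ≤ c₀`
  obtain ⟨β₃, hβ₃1, hP⟩ := exists_const_mul_boxSide_pow_mul_rpow_le ((3 + 2 / g) / c₀) 3
    (θ := θ) (a := (ε - 1 / 2) + g / 2) (b := 0) hθ (by rw [hε, hg]; push_cast; nlinarith)
  refine ⟨max (max β₁ β₂) β₃, fun β hβ => ?_⟩
  have hβ1' : β₁ ≤ β := le_trans (le_trans (le_max_left _ _) (le_max_left _ _)) hβ
  have hβ2' : β₂ ≤ β := le_trans (le_trans (le_max_right _ _) (le_max_left _ _)) hβ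
  have hβ3' : β₃ ≤ β := le_trans (le_max_right _ _) hβ
  have hβ1 : 1 ≤ β := hβ₂1.trans hβ2'
  have hβ0 : 0 < β := by linarith
  have hlog := one_add_log_boxSide_le (g := g) hβ1 hθ.le (by linarith) hg0
  obtain ⟨hH1, hH2⟩ := one_le_ceil_rpow_and_le hβ1 hθ.le
  have hrarβ := hrar β hβ1'
  have hAβ := hA β hβ2'
  have hPβ := hP β hβ3'
  clear hrar hA hP
  set H : ℕ := ⌈β ^ θ⌉₊ with hH
  have hHnat : 1 ≤ H := by exact_mod_cast hH1
  have hlog0 : 0 ≤ 1 + Real.log (H : ℝ) := by linarith [Real.log_nonneg hH1]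
  have hHle : (H : ℝ) ≤ 2 * (H : ℝ) + 3 := by linarith
  -- the small-plaquette scale `s = β^(ε - 1/2)`
  have hs0 : 0 ≤ β ^ (ε - 1 / 2) := by positivity
  have hs2 : (β ^ (ε - 1 / 2)) ^ 2 = β ^ (2 * ε - 1) := by
    rw [← Real.rpow_natCast, ← Real.rpow_mul hβ0.le]; congr 1; push_cast; ring
  have hg2 : (β ^ (g / 2)) ^ 2 = β ^ g := by
    rw [← Real.rpow_natCast, ← Real.rpow_mul hβ0.le]; congr 1; push_cast; ring
  have hlogsq : (1 + Real.log (H : ℝ)) ^ 2 ≤ ((3 + 2 / g) * β ^ (g / 2)) ^ 2 := by gcongr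
  -- premise of U2
  have hprem : β ^ (ε - 1 / 2) * (H : ℝ) ^ 3 * (1 + Real.log H) ≤ c₀ := by
    rw [Real.rpow_zero] at hPβ
    have hH3 : (H : ℝ) ^ 3 ≤ (2 * (H : ℝ) + 3) ^ 3 := by gcongr
    have hsplit : β ^ (ε - 1 / 2 + g / 2) = β ^ (ε - 1 / 2) * β ^ (g / 2) := Real.rpow_add hβ0 _ _
    calc β ^ (ε - 1 / 2) * (H : ℝ) ^ 3 * (1 + Real.log H)
        ≤ β ^ (ε - 1 / 2) * (2 * (H : ℝ) + 3) ^ 3 * ((3 + 2 / g) * β ^ (g / 2)) := by gcongr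
      _ = c₀ * ((3 + 2 / g) / c₀ * (2 * (H : ℝ) + 3) ^ 3 * β ^ (ε - 1 / 2 + g / 2)) := by
          rw [hsplit]; field_simp
      _ ≤ c₀ * 1 := by gcongr
      _ = c₀ := mul_one _
  -- radius: the U2 defect bound fits inside the gauge ball of radius `β^(-1/2 + κ)`
  have hrad : C * (H : ℝ) ^ 2 * (1 + Real.log H) ^ 2 * (β ^ (ε - 1 / 2)) ^ 2 ≤ (β ^ (-(1 : ℝ) / 2 + (1 / 4 + θL / 2))) ^ 2 := by
    have hH2' : (H : ℝ) ^ 2 ≤ (2 * (H : ℝ) + 3) ^ 2 := by gcongr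
    have hr2 : (β ^ (-(1 : ℝ) / 2 + (1 / 4 + θL / 2))) ^ 2 = β ^ (2 * (1 / 4 + θL / 2) - 1) := by
      rw [← Real.rpow_natCast, ← Real.rpow_mul hβ0.le]; congr 1; push_cast; ring
    have hsplit : β ^ (g + (2 * ε - 1)) = β ^ g * β ^ (2 * ε - 1) := Real.rpow_add hβ0 _ _
    calc C * (H : ℝ) ^ 2 * (1 + Real.log H) ^ 2 * (β ^ (ε - 1 / 2)) ^ 2
        ≤ C * (2 * (H : ℝ) + 3) ^ 2 * ((3 + 2 / g) * β ^ (g / 2)) ^ 2 * (β ^ (ε - 1 / 2)) ^ 2 := by gcongr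
      _ = C * (3 + 2 / g) ^ 2 * (2 * (H : ℝ) + 3) ^ 2 * β ^ (g + (2 * ε - 1)) := by
          rw [hs2, mul_pow, hg2, hsplit]; ring
      _ ≤ β ^ (2 * (1 / 4 + θL / 2) - 1) := hAβ
      _ = (β ^ (-(1 : ℝ) / 2 + (1 / 4 + θL / 2))) ^ 2 := hr2.symm
  -- pointwise: cold wall ∧ no large field ⇒ in the gauge ball (via U2)
  have hpt : ∀ U : LGConfig 4 SU2, ColdWall H U → U ∈ coldGoodSet β ε H →
      InGaugeBall H (β ^ (-(1 : ℝ) / 2 + (1 / 4 + θL / 2))) U := by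
    intro U hcold hgood
    have hgood' : ∀ p ∈ plaquettesTouching (boxEdges 4 (2 * H + 1)),
        plaqCostAt (fundamentalRep (Fin 2)) p.1 p.2.1.1 p.2.1.2 U < (β ^ (ε - 1 / 2)) ^ 2 := by
      simp only [coldGoodSet, Set.mem_compl_iff, Set.mem_setOf_eq, not_exists, not_and, not_le] at hgood
      intro p hp
      have := hgood p hp
      rw [hs2]; unfold plaqCostAt; push_cast; linarith
    have hsmall : SmallPlaquettes H (β ^ (ε - 1 / 2)) U := smallPlaquettes_of_coldWall_of_good hcold hgood'
    obtain ⟨gT, hgT, -, hdef⟩ := h4 H hHnat _ hs0 hprem U hcold hsmall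
    exact ⟨gT, hgT, fun e he => (hdef e he).trans hrad⟩
  -- measure bound: cold wall a.s. (DLR properness), then monotonicity + rarity
  have hγ : Literature.Probability.LatticeModels.IsSpecification (ymSpecification (d := 4) (fundamentalRep (Fin 2)) β) :=
    isSpecification_ymSpecification_of_t2Space (fundamentalRep (Fin 2)) (continuous_fundamentalRep (Fin 2)) β
  have hae : ∀ᵐ U ∂(boxState (fundamentalRep (Fin 2)) β H), ColdWall H U := by
    have hprop := hγ.proper (boxEdges 4 (2 * H + 1)) (fun _ => 1)
    show ∀ᵐ U ∂(ymSpecification (fundamentalRep (Fin 2)) β (boxEdges 4 (2 * H + 1)) (fun _ => 1)), ColdWall H U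
    filter_upwards [hprop] with U hU
    exact fun e he => hU e he
  have hmono : boxState (fundamentalRep (Fin 2)) β H {U | ¬ InGaugeBall H (β ^ (-(1 : ℝ) / 2 + (1 / 4 + θL / 2))) U} ≤
      boxState (fundamentalRep (Fin 2)) β H (coldGoodSet β ε H)ᶜ := by
    refine measure_mono_ae ?_
    filter_upwards [hae] with U hU
    intro hnot
    exact Set.mem_compl fun hgoodc => hnot (hpt U hU hgoodc)
  haveI : IsFiniteMeasure (boxState (fundamentalRep (Fin 2)) β H) := by
    unfold boxState ymSpecification; infer_instance
  have hset : (coldGoodSet β ε H)ᶜ = {U : LGConfig 4 SU2 | ∃ p ∈ plaquettesTouching (boxEdges 4 (2 * H + 1)),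
      β ^ (2 * ε - 1) ≤ (2 : ℝ) - plaquetteObs (fundamentalRep (Fin 2)) p.1 p.2.1.1 p.2.1.2 U} := by
    rw [coldGoodSet, compl_compl]
  calc boxState (fundamentalRep (Fin 2)) β H {U | ¬ InGaugeBall H (β ^ (-(1 : ℝ) / 2 + (1 / 4 + θL / 2))) U}
      ≤ boxState (fundamentalRep (Fin 2)) β H (coldGoodSet β ε H)ᶜ := hmono
    _ = ENNReal.ofReal ((boxState (fundamentalRep (Fin 2)) β H).real (coldGoodSet β ε H)ᶜ) :=
        (ENNReal.ofReal_toReal (measure_ne_top _ _)).symm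
    _ ≤ ENNReal.ofReal (Real.exp (-(β ^ ε))) := by
        apply ENNReal.ofReal_le_ofReal
        rw [hset]; exact hrarβ
    _ ≤ ENNReal.ofReal (Real.exp (-(β ^ g))) := by
        apply ENNReal.ofReal_le_ofReal
        apply Real.exp_le_exp.2
        have : β ^ g ≤ β ^ ε := Real.rpow_le_rpow_of_exponent_le hβ1 hgε
        linarith

/-- **U4 (gauge-ball reduction with the SHARP interlock) — NOT a stub (v2): proved from U2.**  For every θL < 1/10 the radius exponent
`κ = 1/4 + θL/2` satisfies `3θL < κ < 1/2 − 2θL` (non-empty iff θL < 1/10; at θL = 1/11: κ = 13/44 ∈ (3/11, 7/22)) and makes the complement of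
the gauge ball exponentially rare.  The upper bound `κ < 1/2 − 2θL` is what U5 consumes (U3 at radius `β^(κ−1/2)`: `r·H → 0`; convexity: `r·H² → 0`). -/
theorem gaugeBallReductionSharp :
    ∀ θL : ℝ, θL < 1 / 10 → ∃ κ : ℝ, 0 < κ ∧ κ < 1 / 2 - 2 * θL ∧ GaugeBallReduction θL κ :=
  gaugeBallReductionSharp_of_strong stub_landauRepresentativeStrong

/-- **U5 (the analytic heart at rung k = 3; XL).**  On the gauge ball (U4, measure-exhausting) pass to the small Landau representative (U2 at the
plaquette scale on the landed good event `boxState_largeField_rarity`, ε > 2θ), unique in the ball by U3 (`r·H → 0`), FP/Haar change of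
variables onto the convex body `K = Slice ∩ Ball(β^(κ−1/2))`, where `βS − log det M_FP − log J_Haar` is uniformly convex with Hessian
`≥ β(1 − o(1))·hodgeQ` as a form on the slice (`r·H + r·H² → 0` by the interlock; S1 ✓p719062 gives the `H⁻²` floor); then the tilt expansion
of LINE-17/19 (Gaussian chaos + hypercontractivity, tree ✓p708257/✓p708688) carried ONE order further: the odd orders vanish by `t ↦ −t`, the
order-β⁻¹ classes (one quartic vertex; two cubic vertices; FP-determinant and Haar quadratic terms; the observables' own cubic/quartic parts) are
BOUNDED class by class with U1 (`≤ C(log H)^m·H²·T⁻⁶`, summable/marginal lattice sums; one-gluon-reducible classes vanish: no SO(3)-invariant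
vector in the adjoint), the third-order remainder is `σ³ = (H⁴(log H)^m/β)^{3/2}` against `T⁻⁸ ≥ H⁻⁸` (14θ < 3/2), and the exponential-moment
cap on K ∩ SmallPlaquettes is `S·σ² ≍ H⁸β^(ε+2κ−3/2) → 0` (16θ + 5g < 3/2 ✓ at 1/11; optional upgrade: Brascamp–Lieb/Bakry–Émery concentration
in the hodgeQ metric shrinks the ball to `β^(−1/2+δ)` first, cap 3/16).  Gauge-INVARIANT conclusion (Elitzur): only `boxPlaqCov`, `boxDirCircSqCov`.
Range θL < 1/10 = U2's premise ∧ U4's interlock.  STAFFING governed by critic prereg N2 (exact `c₁(H,T)`, instrument I23).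
v4 NOTE (g18 re-cut): the CONCLUSION is the BULK comparison `LandauRelativeComparisonBulk θL` (separations `L ≤ T ≤ H/M`, constants the prover's). -/
theorem stub_landauThirdOrder : ∀ θL : ℝ, θL < 1 / 10 → LandauKernelPackage → LandauRepresentativeBound → LandauBallUniqueness →
    (∃ κ : ℝ, 0 < κ ∧ κ < 1 / 2 - 2 * θL ∧ GaugeBallReduction θL κ) →
    LandauRelativeComparisonBulk θL := by sorry

/-- **U6 — DECLARED RESIDUAL: the windows θ > 1/11.**  NOT attacked (renormalisation-group regime; this chart's ceiling is 1/10, 1/8 with the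
unfiled sharpenings).  Typed with the LineDefs Prop `BoxWindowHighSU22` at 1/11; a route item `BoxWindowHighSU2211` with this body (asked of
director-ym, precedent ⟨24336⟩) would be definitionally equal. -/
theorem stub_boxWindowHigh11 : BoxWindowHighSU22 (1 / 11) := by sorry

/-! ## Kernel-checked compositions (no sorry) -/

/-- Not a stub: the T-respecting currency is the landed helper ✓p706506. -/
theorem relativeCurrency : RelativeCurrency := fun θc h =>
  Summit.QuantumFields.YangMills.Theorems.AllWindowsColdBox.boxWindow_of_dirichletDominationRel_ceiling θc h

/-- Local alias of the HIGH item ⟨stmt-QuantumFields-24336⟩. -/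
abbrev HighGoal : Prop := Summit.QuantumFields.YangMills.Theses.AllWindowsColdBox.BoxWindowHighSU2213

/-- Local alias of the parent crux ⟨stmt-QuantumFields-24004⟩. -/
abbrev CruxGoal : Prop := Summit.QuantumFields.YangMills.Theses.AllWindowsColdBox.BoxHighWindowsSU22

/-- stubs U1–U5 ⟹ every window `θ ≤ θL`, for any `θL < 1/10` (v4: via the BULK currency, tree theorem `boxWindow_of_dirichletDominationBulk_ceiling`). -/
theorem boxWindowUpTo_of (θL : ℝ) (hθL : θL < 1 / 10)
    (h1 : LandauKernelPackage) (h2 : LandauRepresentativeBound) (h3 : LandauBallUniqueness)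
    (h4 : ∀ θL' : ℝ, θL' < 1 / 10 → ∃ κ : ℝ, 0 < κ ∧ κ < 1 / 2 - 2 * θL' ∧ GaugeBallReduction θL' κ)
    (h5 : ∀ θL' : ℝ, θL' < 1 / 10 → LandauKernelPackage → LandauRepresentativeBound → LandauBallUniqueness →
      (∃ κ : ℝ, 0 < κ ∧ κ < 1 / 2 - 2 * θL' ∧ GaugeBallReduction θL' κ) → LandauRelativeComparisonBulk θL')
    (h6 : RelativeCurrencyBulk) : BoxWindowUpToSU22 θL := by
  have hC : LandauRelativeComparisonBulk θL := h5 θL hθL h1 h2 h3 (h4 θL hθL)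
  intro A θ hA hAθ hθle
  exact h6 θL hC A θ hA hAθ hθle

/-- windows up to `hi` ⟹ the window `(lo, hi]` (forgetting the lower cut and the `θ ≤ 7A` side condition). -/
theorem boxWindow_of_upTo (lo hi : ℝ) (h : BoxWindowUpToSU22 hi) : BoxWindowSU22 lo hi :=
  fun A θ hA hAθ _h7 _hlo hhi => h A θ hA hAθ hhi

/-- The case split at `hi`: windows up to `hi` ∧ the residual above `hi` ⟹ the HIGH item above `1/13` (as `HighGoal`), for any `hi`. -/
theorem boxWindowHigh13_of_split (hi : ℝ) (hup : BoxWindowUpToSU22 hi) (hres : BoxWindowHighSU22 hi) : HighGoal := by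
  intro A θ hA hAθ h7 _h13
  by_cases hθ : θ ≤ hi
  · exact hup A θ hA hAθ hθ
  · exact hres A θ hA hAθ h7 (lt_of_not_ge hθ)

/-- The same split ⟹ the parent crux (all windows θ > 1/16), as `CruxGoal`. -/
theorem boxHighWindows_of_split (hi : ℝ) (hup : BoxWindowUpToSU22 hi) (hres : BoxWindowHighSU22 hi) : CruxGoal := by
  intro A θ hA hAθ h7 _h16
  by_cases hθ : θ ≤ hi
  · exact hup A θ hA hAθ hθ
  · exact hres A θ hA hAθ h7 (lt_of_not_ge hθ)

/-- The route item ⟨stmt-QuantumFields-24336⟩ IS `BoxWindowHighSU22 (1/13)` (by `Iff.rfl`). -/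
theorem boxWindowHighSU2213_iff : HighGoal ↔ BoxWindowHighSU22 (1 / 13) := Iff.rfl

/-- **Composition for the line's honest deliverable** (hypotheses = exactly the five Landau stub statements U1 U2 U3 U4 U5, in order): the MID
window `1/13 < θ ≤ 1/11`.  No residual is used here. -/
theorem BoxWindowMid_of :
    LandauKernelPackage → LandauRepresentativeBound → LandauBallUniqueness →
    (∀ θL : ℝ, θL < 1 / 10 → ∃ κ : ℝ, 0 < κ ∧ κ < 1 / 2 - 2 * θL ∧ GaugeBallReduction θL κ) →
    (∀ θL : ℝ, θL < 1 / 10 → LandauKernelPackage → LandauRepresentativeBound → LandauBallUniqueness →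
      (∃ κ : ℝ, 0 < κ ∧ κ < 1 / 2 - 2 * θL ∧ GaugeBallReduction θL κ) → LandauRelativeComparisonBulk θL) →
    BoxWindowSU22 (1 / 13) (1 / 11) :=
  fun h1 h2 h3 h4 h5 => boxWindow_of_upTo _ _ (boxWindowUpTo_of (1 / 11) (by norm_num) h1 h2 h3 h4 h5 boxWindow_of_dirichletDominationBulk_ceiling)

/-- **Composition for ⟨stmt-QuantumFields-24336⟩** (hypotheses = the six stub statements U1 … U6, in order; conclusion the local alias). -/
theorem BoxWindowHighSU2213_of :
    LandauKernelPackage → LandauRepresentativeBound → LandauBallUniqueness →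
    (∀ θL : ℝ, θL < 1 / 10 → ∃ κ : ℝ, 0 < κ ∧ κ < 1 / 2 - 2 * θL ∧ GaugeBallReduction θL κ) →
    (∀ θL : ℝ, θL < 1 / 10 → LandauKernelPackage → LandauRepresentativeBound → LandauBallUniqueness →
      (∃ κ : ℝ, 0 < κ ∧ κ < 1 / 2 - 2 * θL ∧ GaugeBallReduction θL κ) → LandauRelativeComparisonBulk θL) →
    BoxWindowHighSU22 (1 / 11) → HighGoal :=
  fun h1 h2 h3 h4 h5 h6 => boxWindowHigh13_of_split (1 / 11) (boxWindowUpTo_of (1 / 11) (by norm_num) h1 h2 h3 h4 h5 boxWindow_of_dirichletDominationBulk_ceiling) h6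

/-- **Composition for the parent crux ⟨stmt-QuantumFields-24004⟩** (same six hypotheses; the residual of the crux moves from θ > 1/13
(LINE-19) to θ > 1/11). -/
theorem BoxHighWindowsSU22_of :
    LandauKernelPackage → LandauRepresentativeBound → LandauBallUniqueness →
    (∀ θL : ℝ, θL < 1 / 10 → ∃ κ : ℝ, 0 < κ ∧ κ < 1 / 2 - 2 * θL ∧ GaugeBallReduction θL κ) →
    (∀ θL : ℝ, θL < 1 / 10 → LandauKernelPackage → LandauRepresentativeBound → LandauBallUniqueness →
      (∃ κ : ℝ, 0 < κ ∧ κ < 1 / 2 - 2 * θL ∧ GaugeBallReduction θL κ) → LandauRelativeComparisonBulk θL) →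
    BoxWindowHighSU22 (1 / 11) → CruxGoal :=
  fun h1 h2 h3 h4 h5 h6 => boxHighWindows_of_split (1 / 11) (boxWindowUpTo_of (1 / 11) (by norm_num) h1 h2 h3 h4 h5 boxWindow_of_dirichletDominationBulk_ceiling) h6

/-- **THE SKELETON THEOREM for ⟨stmt-QuantumFields-24336⟩** (the unique theorem of this file concluding
`Summit.QuantumFields.YangMills.Theses.AllWindowsColdBox.BoxWindowHighSU2213` BY NAME; no hypotheses; `sorry` only inside the six declared stubs
U1 U2 U5 + the declared residual U6; U3 = landed ✓p723285, U4 = the in-file theorem `gaugeBallReductionSharp`). -/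
theorem BoxWindowHighSU2213_proof : Summit.QuantumFields.YangMills.Theses.AllWindowsColdBox.BoxWindowHighSU2213 :=
  BoxWindowHighSU2213_of stub_landauKernelPackage stub_landauRepresentativeStrong landauBallUniqueness_holds
    gaugeBallReductionSharp stub_landauThirdOrder stub_boxWindowHigh11

/-- **THE SKELETON THEOREM for the parent crux ⟨stmt-QuantumFields-24004⟩** (the unique theorem of this file concluding
`Summit.QuantumFields.YangMills.Theses.AllWindowsColdBox.BoxHighWindowsSU22` BY NAME; no hypotheses; same four stubs + U3 landed + U4 theorem). -/
theorem BoxHighWindowsSU22_proof : Summit.QuantumFields.YangMills.Theses.AllWindowsColdBox.BoxHighWindowsSU22 :=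
  BoxHighWindowsSU22_of stub_landauKernelPackage stub_landauRepresentativeStrong landauBallUniqueness_holds
    gaugeBallReductionSharp stub_landauThirdOrder stub_boxWindowHigh11

end Summit.QuantumFields.YangMills.Cruxes.BoxWindowHighSU2213.LandauRung3

end
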